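import Summits.ABC.IUTFork.Cor312VerbatimReadings
import Summits.ABC.IUTFork.Cor312EdgeYamashitaIVT
import HarnessLib

/-!
# The fork at [IUTchIII] Corollary 3.12 — Reading 4 (Yamashita) on the HONEST `(ℝ, Lebesgue)` toy container

Record-only file (D-0012) of the abc-iut cell; TAKES NO SIDE. Proof-only corollary of `Cor312VerbatimReadings.lean`
(abc-iut-c312-6, W2-C) and `Cor312EdgeYamashitaIVT.lean` (abc-iut-w5-d018).

`Cor312VerbatimReadings` §2 places the readings of Step (xi) inside a REAL container — the `(ℝ, Lebesgue)` toy of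
`Cor312Bridge` (`toySetting a b h`: one possible image, the box over `[0,1]`; `q`-pilot image the box over `[a,b]`;
log-volume `log (b − a)`) — and shows (`verbatim_edge_not_imp_readings`) that for the witness `[2, 5/2]` the inequality
holds while Readings 1, 2, 3 and LANA's (9-1) all FAIL. `Cor312EdgeYamashitaIVT` shows abstractly that Yamashita's
Reading 4 at volume level (`QIsoInHull` = `QCongruentSubHull` = `QCopyInHull`: "the hull contains an admissible region
of log-volume `−|log(q)|`") is EQUIVALENT to the inequality in any container with intermediate values.

Here the two meet (kernel facts, nothing asserted about any model of [IUTchIII]):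
* `toySetting_ivt` — the honest toy container HAS the intermediate-value property at its hull: every `y ≤ 0 = ln ν̄([0,1])`
  is the log-volume of the admissible sub-box over `[0, e^y]`;
* `toySetting_qIsoInHull_iff` — hence for EVERY toy `q`-box, Reading 4 ⟺ `log (b − a) ≤ 0` ⟺ Cor. 3.12
  (`toySetting_cor312_iff`): in an honest container Reading 4 IS the inequality;
* `readingsWitness_qIsoInHull`, `honest_yamashita_not_imp_readings` — in c312-6's witness Reading 4 HOLDS (the sub-box over
  `[0, ½]`) while R1, R2, R3, (9-1) fail: the separation "R4 strictly weaker than R1–R3" of V-d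
  (`yamashita_not_imp_readings`, counting volume) now with Lebesgue measure — whereas V-d's OTHER separation, "the
  inequality does not give R4" (`edge_not_imp_yamashita`), has NO honest-measure analogue here, exactly as the IVT
  theorem predicts.

[cite: Yamashita2024IUTSurvey, Cor. 13.13 proof p. 360 ll. 30–40] [claim: Mochizuki2012, status: disputed]
Deliberately NOT here: anything about the M-level containers (tensor-packet log-shells); any judgement.
-/

noncomputable section

open Set MeasureTheory

namespace Summit.ABC

namespace IUTFork

namespace Cor312Vol

open Thm311 Cor312 Cor312Proof

/-! ## 1. The toy container has intermediate values at its hull -/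

/-- Boxes over nested intervals are nested: `[0, c] ⊆ [0, 1]` for `c ≤ 1` gives `toyBox 0 c ⊆ toyBox 0 1`. [folklore] -/
theorem toyBox_zero_subset {c : ℝ} (hc : c ≤ 1) : toyBox 0 c ⊆ toyBox 0 1 := by
  intro f hf
  refine Set.mem_univ_pi.mpr fun u => Set.mem_univ_pi.mpr fun v => ?_
  have h := (Set.mem_univ_pi.mp ((Set.mem_univ_pi.mp hf) u)) v
  exact ⟨h.1, h.2.trans hc⟩

/-- The hull of the toy setting is the unit box. [folklore] -/
theorem toySetting_Uhol (a b : ℝ) (h : a < b) : (toySetting a b h).Uhol = toyBox 0 1 := by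
  show toyFamily.assemble.hull (⋃ _ : Unit, toyBox 0 1) = toyBox 0 1
  exact toyFamily_hull_box

/-- **The honest toy container has the intermediate-value property at its hull** (hypothesis `ivt` of
`Cor312Setting.qCongruentSubHull_iff_cor312_of_ivt`): every `y ≤ ln ν̄(U^{hol}) = 0` is the log-volume of the
admissible sub-box over `[0, e^y]`. [folklore] -/
theorem toySetting_ivt (a b : ℝ) (h : a < b) :
    ∀ y : ℝ, (∃ A, (toySetting a b h).Adm A ∧ (toySetting a b h).logvol A = y) →
      y ≤ (toySetting a b h).logvol (toySetting a b h).Uhol →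
        ∃ R, (toySetting a b h).Adm R ∧ R ⊆ (toySetting a b h).Uhol ∧ (toySetting a b h).logvol R = y := by
  intro y _ hy
  have hy0 : y ≤ 0 := by
    have h1 : (toySetting a b h).logvol (toySetting a b h).Uhol = 0 := by
      rw [toySetting_Uhol]
      show toyFamily.assemble.logvol (toyBox 0 1) = 0
      rw [toyFamily_logvol one_pos, sub_zero, Real.log_one]
    rwa [h1] at hy
  refine ⟨toyBox 0 (Real.exp y), toyBox_adm (Real.exp_pos y), ?_, ?_⟩
  · rw [toySetting_Uhol]
    exact toyBox_zero_subset (Real.exp_le_one_iff.mpr hy0)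
  · show toyFamily.assemble.logvol (toyBox 0 (Real.exp y)) = y
    rw [toyFamily_logvol (Real.exp_pos y), sub_zero, Real.log_exp]

/-! ## 2. Reading 4 on the toy: it IS the inequality -/

/-- **In the honest toy container Reading 4 ⟺ Cor. 3.12 ⟺ `log (b − a) ≤ 0`** (p413721's IVT theorem instantiated;
`toySetting_cor312_iff`). [folklore] -/
theorem toySetting_qIsoInHull_iff (a b : ℝ) (h : a < b) :
    (toySetting a b h).QIsoInHull ↔ Real.log (b - a) ≤ 0 := by
  rw [← toySetting_cor312_iff a b h]
  exact (toySetting a b h).qCongruentSubHull_iff_cor312_of_ivt (toySetting_ivt a b h)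

/-- **Reading 4 HOLDS in c312-6's witness** (`q`-image the box over `[2, 5/2]`): the sub-box over `[0, ½]` of the hull
`[0, 1]` is admissible of log-volume `log ½ = −|log(q)|`. Direct witness (no IVT needed). [folklore] -/
theorem readingsWitness_qIsoInHull : readingsWitness.QIsoInHull := by
  refine ⟨toyBox 0 (1 / 2), toyBox_adm (by norm_num), ?_, ?_⟩
  · show toyBox 0 (1 / 2) ⊆ (toySetting 2 (5 / 2) (by norm_num)).Uhol
    rw [toySetting_Uhol]
    exact toyBox_zero_subset (by norm_num)
  · rw [readingsWitness_negAbsLogq]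
    show toyFamily.assemble.logvol (toyBox 0 (1 / 2)) = Real.log (1 / 2)
    rw [toyFamily_logvol (by norm_num : (0 : ℝ) < 1 / 2), sub_zero]

/-- **Honest-measure separation of Reading 4 from Readings 1–3**: in the `(ℝ, Lebesgue)` witness Reading 4 holds
(all three twin typings), Cor. 3.12 holds, and R1, R2, R3, LANA (9-1) fail — V-d's `yamashita_not_imp_readings` with
Lebesgue measure in place of a counting volume. (V-d's converse separation `edge_not_imp_yamashita` has no analogue
here: by `toySetting_qIsoInHull_iff` the toy cannot separate R4 from the inequality.) [folklore] -/
theorem honest_yamashita_not_imp_readings :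
    readingsWitness.QIsoInHull ∧ readingsWitness.QCongruentSubHull ∧ readingsWitness.QCopyInHull ∧
      readingsWitness.Cor312 ∧ ¬ readingsWitness.RepresentedVol ∧ ¬ readingsWitness.QSubHull ∧
        ¬ readingsWitness.QIsImage ∧ ∀ Rval, ¬ (readingsWitness.toEtaSetting Rval).MainGoal := by
  obtain ⟨-, hrep, hsub, himg, hmain⟩ := verbatim_edge_not_imp_readings
  have h4 := readingsWitness_qIsoInHull
  exact ⟨h4, h4, h4, readingsWitness.cor312_of_qIsoInHull h4, hrep, hsub, himg, hmain⟩

end Cor312Vol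

end IUTFork

end Summit.ABC

end
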